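import Summits.BirchSwinnertonDyer.Rank1Residual.GaloisImage.KolyvaginDerivativeEulerRelation
import Literature.NumberTheory.GaloisRepresentations.RestrictedRamification
import HarnessLib

/-!
# Kolyvagin's derivative classes are unramified away from `r p`: THEOREM B-ur of row T-DER
# ([Rubin00] Thm. 4.5.1 / [MR04] Prop. A.2 at the good primes — the bookkeeping half)
# (cell `b2b-bsdres`, team n1011, seat p11 GEN 8, OWNERS row T-DER = skel/T-DER.md STATUS v5; file F7)

HONEST FRAMING (cell `b2b-bsdres`, run/shared/lean/b2b/bsd-rank1-residual/, verbatim in every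
file): the goal of the cell is to DELETE the COMBINATION-SHAPED residual classes of the
Birch–Swinnerton-Dyer formula for ALL analytic-rank `≤ 1` elliptic curves over `ℚ` — "full BSD
formula for every rank `≤ 1` curve in class `C`" assembled STRICTLY from published theorems — so
that the rank-`≤ 1` remainder becomes exactly the CONSTRUCTION-SHAPED classes, which are TYPED
(missing-input `Prop`s), NOT attempted. This is not "finishing BSD". Team n1011 (N10 / N11, the
additive block X4 ∧ `p = 3`): research route on the CONSTRUCTION-SHAPED class X4; no claim beyond the
stated classes; nothing is booked. TOOL theorems of continuous group cohomology (no definition, no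
named fact, no `sorry`); curve-free, `p`-free, Euler-system-free.

## What

Write, for a class `y ∈ H¹(H, X)` (`H ⊴ G` open, `X` a topological representation of `G`) and a
subset `S ⊆ H`: **`Van_S(y)` := every representative cocycle of `y` vanishes on `S`** (spelled out
in each statement; no definition is introduced).  When `S` acts trivially on `X`, one vanishing
representative suffices (`forall_apply_eq_zero_of_exists`, coboundaries vanish on `S`), and:

§1 BOOKKEEPING — `Van_S` is preserved by `0`, `+`, `−`, `n •` (`…_zero/_add/_neg/_nsmul`); by the
`G`-action `conjMap` when `S` is stable under conjugation (`…_conjMap`: `(g·φ)(u) = g φ(g⁻¹ u g)`);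
by every endomorphism in the algebra they generate, in particular by Kolyvagin's derivative
operator `D_r = ∏_{ℓ ∈ r} Σ_{j<N_ℓ} j σ_ℓ^j` (`…_noncommProd_deriv`, via
`Finset.noncommProd_induction`); by coefficient change `red_*` along an equivariant `red : X ⟶ X′`
with `S` trivial on `X′` (`…_map_red`); and it DESCENDS: if `κ ∈ H¹(G, X)` restricts to `y` on
`H ⊇ S` then every representative of `κ` vanishes on `S` (`…_of_resSubgroup_eq`).

§2 **THEOREM B-ur** (`apply_eq_zero_of_resSubgroup_eq_deriv`): over a number field `K`, for a
finite place `v`, an open normal `U ⊴ Γ_K` UNRAMIFIED at `v` (`I_𝔓 ≤ U` for all `𝔓 ∣ v`),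
representations `X → X′` with every `I_𝔓`, `𝔓 ∣ v`, acting trivially on `X′`, and a class
`x ∈ H¹(U, X)` all of whose representatives vanish on every `I_𝔓`, `𝔓 ∣ v`: **every class
`κ ∈ H¹(Γ_K, X′)` with `res_U κ = D_r (red_* x)` has all its representatives vanishing on every
`I_𝔓`, `𝔓 ∣ v`** — i.e. `κ` is unramified at `v`.  Applied to an Euler system (`x = c_{⊥,r}`,
`U = Gal(K̄/K(r))`, `κ = κ_r` of THEOREM A3 `existsUnique_res_eq_deriv`) with the input supplied
by F6 (`Inertia.apply_eq_zero_of_mem_inertia`: `c_{⊥,r}` vanishes on inertia above every good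
`v ∉ r`, `v ∤ p`, from the Frobenius-eigenvalue argument) this is [Rubin00] Thm. 4.5.1 at the
primes `v ∤ r p` where `T` is unramified ([MR04] Prop. A.2; Remark A.5: the derivative classes
land in `𝓕_u`, UNRAMIFIED at `ℓ ≠ p`).  In `ℤ`-currency (p13's coefficient transport GZ-1/GZ-2,
"computed on cocycles") it reads `loc_v κ_r ∈ H¹_ur(K_v, ·)`.  SCOPE (skel/T-DER.md STATUS v5,
referee-1 GEN 30): the places `v ∣ N` (`T` ramified: class-level bookkeeping + universal norms, or
Kato's typed clause), `v ∣ p` ([MR04] Lemma A.1, the D7 locus `E(ℚ_p)[p] = 0`) and `v ∣ ∞` are NOT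
treated here.  INPUT CURRENCY for Kato's Euler system (p13 GEN 9 custodian note, (P-KATO) design
D3 "`z_m` unramified outside `pΣm`"): the hypothesis `hx` below is COCYCLE-LEVEL — "every
representative `φ` of the class vanishes on `𝔓.inertia Γ_K` for every `𝔓 ∣ v`" — and D3 should be
typed literally in this shape so that it feeds `hx` by `exact` (F6 supplies `hx` instead from the
structure of `T_p E` at the good primes, with no Euler-system input).

References: K. Rubin, *Euler Systems* (2000), Thm. 4.5.1, Def. 4.4.4; B. Mazur, K. Rubin,
*Kolyvagin systems*, Mem. AMS 799 (2004), App. A, Prop. A.2, Remark A.5, eqs. (34)–(35)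
(pp. 79–83); K. Rubin, *Euler systems and Kolyvagin systems*, PCMS 18 (2011), Thm. 4.3.10 (1).
-/

noncomputable section

open CategoryTheory Function Finset Field IsDedekindDomain
open scoped NumberField Pointwise
open Literature.NumberTheory.GaloisRepresentations
open Literature.NumberTheory.EllipticCurves (subgroupConj subgroupConj_apply_coe)

universe u v

namespace Summit.BirchSwinnertonDyer.Rank1Residual.GaloisImage

namespace Derivative

/-! ### §1 Bookkeeping: classes all of whose representatives vanish on `S` -/

section Van

variable {R : Type v} [CommRing R] [TopologicalSpace R]
variable {G : Type u} [Group G] [TopologicalSpace G] [IsTopologicalGroup G]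
variable (X : TopRep.{u} R G) (H : Subgroup G) {S : Set G} (hSH : S ⊆ H)

/-- If `S ⊆ H` acts trivially on `X`, a class of `H¹(H, X)` with ONE representative vanishing on
`S` has ALL its representatives vanishing on `S` (two representatives differ by a coboundary
`u ↦ u·w − w`, zero on `S`). [folklore] -/
theorem forall_apply_eq_zero_of_exists (hS : ∀ s ∈ S, ∀ x : X, X.ρ s x = x)
    {y : continuousCohomology 1 (subgroupRep X H)}
    (h : ∃ φ : contOneCocycles (subgroupRep X H), oneCocycleClass _ φ = y ∧
      ∀ s (hs : s ∈ S), φ.1 ⟨s, hSH hs⟩ = 0)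
    (ψ : contOneCocycles (subgroupRep X H)) (hψ : oneCocycleClass _ ψ = y)
    (s : G) (hs : s ∈ S) : ψ.1 ⟨s, hSH hs⟩ = 0 := by
  obtain ⟨φ, hφ, h0⟩ := h
  have hd : oneCocycleClass _ (ψ - φ) = 0 := by rw [oneCocycleClass_sub, hψ, hφ, sub_self]
  obtain ⟨w, hw⟩ := (oneCocycleClass_eq_zero_iff _ _).mp hd
  have h1 := hw ⟨s, hSH hs⟩
  rw [Submodule.coe_sub, ContinuousMap.sub_apply, h0 s hs, sub_zero, subgroupRep_ρ_apply] at h1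
  rw [h1, hS s hs, sub_self]

/-- The zero class has all representatives vanishing on `S`. [folklore] -/
theorem forall_apply_eq_zero_zero (hS : ∀ s ∈ S, ∀ x : X, X.ρ s x = x)
    (ψ : contOneCocycles (subgroupRep X H)) (hψ : oneCocycleClass _ ψ = 0)
    (s : G) (hs : s ∈ S) : ψ.1 ⟨s, hSH hs⟩ = 0 :=
  forall_apply_eq_zero_of_exists X H hSH hS ⟨0, oneCocycleClass_zero _, fun _ _ => rfl⟩ ψ hψ s hs

/-- `Van_S` is stable under addition. [folklore] -/
theorem forall_apply_eq_zero_add (hS : ∀ s ∈ S, ∀ x : X, X.ρ s x = x)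
    {y₁ y₂ : continuousCohomology 1 (subgroupRep X H)}
    (h₁ : ∀ φ : contOneCocycles (subgroupRep X H), oneCocycleClass _ φ = y₁ →
      ∀ s (hs : s ∈ S), φ.1 ⟨s, hSH hs⟩ = 0)
    (h₂ : ∀ φ : contOneCocycles (subgroupRep X H), oneCocycleClass _ φ = y₂ →
      ∀ s (hs : s ∈ S), φ.1 ⟨s, hSH hs⟩ = 0)
    (ψ : contOneCocycles (subgroupRep X H)) (hψ : oneCocycleClass _ ψ = y₁ + y₂)
    (s : G) (hs : s ∈ S) : ψ.1 ⟨s, hSH hs⟩ = 0 := by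
  obtain ⟨φ₁, rfl⟩ := oneCocycleClass_surjective _ y₁
  obtain ⟨φ₂, rfl⟩ := oneCocycleClass_surjective _ y₂
  refine forall_apply_eq_zero_of_exists X H hSH hS ⟨φ₁ + φ₂, oneCocycleClass_add _ _ _, ?_⟩ ψ hψ s hs
  intro s hs
  rw [Submodule.coe_add, ContinuousMap.add_apply, h₁ φ₁ rfl s hs, h₂ φ₂ rfl s hs, add_zero]

/-- `Van_S` is stable under negation. [folklore] -/
theorem forall_apply_eq_zero_neg (hS : ∀ s ∈ S, ∀ x : X, X.ρ s x = x)
    {y : continuousCohomology 1 (subgroupRep X H)}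
    (h : ∀ φ : contOneCocycles (subgroupRep X H), oneCocycleClass _ φ = y →
      ∀ s (hs : s ∈ S), φ.1 ⟨s, hSH hs⟩ = 0)
    (ψ : contOneCocycles (subgroupRep X H)) (hψ : oneCocycleClass _ ψ = -y)
    (s : G) (hs : s ∈ S) : ψ.1 ⟨s, hSH hs⟩ = 0 := by
  obtain ⟨φ, rfl⟩ := oneCocycleClass_surjective _ y
  refine forall_apply_eq_zero_of_exists X H hSH hS ⟨-φ, ?_, ?_⟩ ψ hψ s hs
  · rw [← oneCocycleClassₗ_apply, map_neg, oneCocycleClassₗ_apply]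
  · intro s hs
    rw [Submodule.coe_neg, ContinuousMap.neg_apply, h φ rfl s hs, neg_zero]

/-- `Van_S` is stable under the `G`-action `conjMap` when `S` is stable under conjugation by `G`:
the representative `u ↦ g · φ(g⁻¹ u g)` of `g · [φ]` vanishes on `S`. [folklore] -/
theorem forall_apply_eq_zero_conjMap [H.Normal] (hS : ∀ s ∈ S, ∀ x : X, X.ρ s x = x)
    (hSconj : ∀ g : G, ∀ s ∈ S, g⁻¹ * s * g ∈ S) (g : G)
    {y : continuousCohomology 1 (subgroupRep X H)}
    (h : ∀ φ : contOneCocycles (subgroupRep X H), oneCocycleClass _ φ = y →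
      ∀ s (hs : s ∈ S), φ.1 ⟨s, hSH hs⟩ = 0)
    (ψ : contOneCocycles (subgroupRep X H)) (hψ : oneCocycleClass _ ψ = conjMap X H g 1 y)
    (s : G) (hs : s ∈ S) : ψ.1 ⟨s, hSH hs⟩ = 0 := by
  obtain ⟨φ, rfl⟩ := oneCocycleClass_surjective _ y
  refine forall_apply_eq_zero_of_exists X H hSH hS ⟨_, (conjMap_oneCocycleClass X H g φ).symm, ?_⟩
    ψ hψ s hs
  intro s hs
  rw [conj_pullback_apply]
  have hconj : subgroupConj H g ⟨s, hSH hs⟩ = ⟨g⁻¹ * s * g, hSH (hSconj g s hs)⟩ :=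
    Subtype.ext (subgroupConj_apply_coe H g _)
  rw [hconj, h φ rfl _ (hSconj g s hs), map_zero]

omit [TopologicalSpace R] in
/-- An additive subgroup `V` of an `R`-module stable under an endomorphism `E` is stable under
`Σ_{j<N} j E^j` (Kolyvagin's `D_σ` for `E = σ`). [folklore] -/
theorem deriv_apply_mem {M : Type*} [AddCommGroup M] [Module R M] (V : AddSubgroup M)
    (E : Module.End R M) (hE : ∀ y ∈ V, E y ∈ V) (N : ℕ) :
    ∀ y ∈ V, (∑ j ∈ range N, (j : Module.End R M) * E ^ j) y ∈ V := by
  have hpow : ∀ j : ℕ, ∀ y ∈ V, (E ^ j) y ∈ V := by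
    intro j
    induction j with
    | zero => intro y hy; simpa using hy
    | succ j ih => intro y hy; rw [pow_succ, Module.End.mul_apply]; exact ih _ (hE y hy)
  intro y hy
  rw [LinearMap.sum_apply]
  refine V.sum_mem fun j _ => ?_
  rw [Module.End.mul_apply, Module.End.natCast_apply]
  exact V.nsmul_mem (hpow j y hy) j

omit [TopologicalSpace R] in
/-- An additive subgroup stable under each `E_ℓ`, `ℓ ∈ r`, is stable under Kolyvagin's derivative
operator `D_r = ∏_{ℓ∈r} Σ_{j<N_ℓ} j E_ℓ^j` (`Finset.noncommProd`), the shape of THEOREM A3's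
conclusion. [folklore] -/
theorem noncommProd_deriv_apply_mem {M : Type*} [AddCommGroup M] [Module R M] (V : AddSubgroup M)
    {ι : Type*} (r : Finset ι) (E : ι → Module.End R M) (N : ι → ℕ)
    (hE : ∀ ℓ ∈ r, ∀ y ∈ V, E ℓ y ∈ V) (comm) :
    ∀ y ∈ V, (r.noncommProd (fun ℓ => ∑ j ∈ range (N ℓ), (j : Module.End R M) * E ℓ ^ j) comm) y ∈ V := by
  refine Finset.noncommProd_induction r _ comm (fun T : Module.End R M => ∀ y ∈ V, T y ∈ V)
    (fun a b ha hb y hy => ?_) (fun y hy => by simpa using hy) fun ℓ hℓ => ?_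
  · rw [Module.End.mul_apply]; exact ha _ (hb y hy)
  · exact deriv_apply_mem V (E ℓ) (hE ℓ hℓ) (N ℓ)

/-- `Van_S` is stable under Kolyvagin's derivative operator
`D_r = ∏_{ℓ∈r} Σ_{j<N_ℓ} j (σ_ℓ ·)^j` on `H¹(H, X)` when `S` acts trivially and is stable under
conjugation ([Rubin00] Def. 4.4.1 operators; [MR04] eq. (34) p. 83). [folklore] -/
theorem forall_apply_eq_zero_noncommProd_deriv [H.Normal] (hS : ∀ s ∈ S, ∀ x : X, X.ρ s x = x)
    (hSconj : ∀ g : G, ∀ s ∈ S, g⁻¹ * s * g ∈ S) {ι : Type*} (r : Finset ι) (σ : ι → G) (N : ι → ℕ)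
    (comm) {y : continuousCohomology 1 (subgroupRep X H)}
    (h : ∀ φ : contOneCocycles (subgroupRep X H), oneCocycleClass _ φ = y →
      ∀ s (hs : s ∈ S), φ.1 ⟨s, hSH hs⟩ = 0)
    (ψ : contOneCocycles (subgroupRep X H))
    (hψ : oneCocycleClass _ ψ = (r.noncommProd (fun ℓ => ∑ j ∈ range (N ℓ),
      (j : Module.End R (continuousCohomology 1 (subgroupRep X H))) *
        (conjMap X H (σ ℓ) 1).hom.toLinearMap ^ j) comm) y)
    (s : G) (hs : s ∈ S) : ψ.1 ⟨s, hSH hs⟩ = 0 := by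
  -- the subgroup of classes all of whose representatives vanish on `S`
  let V : AddSubgroup (continuousCohomology 1 (subgroupRep X H)) :=
    { carrier := {z | ∀ φ : contOneCocycles (subgroupRep X H), oneCocycleClass _ φ = z →
        ∀ s (hs : s ∈ S), φ.1 ⟨s, hSH hs⟩ = 0}
      zero_mem' := fun φ hφ s hs => forall_apply_eq_zero_zero X H hSH hS φ hφ s hs
      add_mem' := fun h₁ h₂ φ hφ s hs => forall_apply_eq_zero_add X H hSH hS h₁ h₂ φ hφ s hs
      neg_mem' := fun h₁ φ hφ s hs => forall_apply_eq_zero_neg X H hSH hS h₁ φ hφ s hs }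
  have hE : ∀ ℓ ∈ r, ∀ z ∈ V, (conjMap X H (σ ℓ) 1).hom.toLinearMap z ∈ V :=
    fun ℓ _ z hz φ hφ s hs => forall_apply_eq_zero_conjMap X H hSH hS hSconj (σ ℓ) hz φ hφ s hs
  have hmem := noncommProd_deriv_apply_mem V r (fun ℓ => (conjMap X H (σ ℓ) 1).hom.toLinearMap) N
    hE comm y h
  exact hmem ψ hψ s hs

variable {X' : TopRep.{u} R G}

/-- `Van_S` passes along coefficient change `red_* : H¹(H, X) → H¹(H, X′)` for an equivariant
`red : X ⟶ X′`, when `S` acts trivially on `X′` (the representative `red ∘ φ`). [folklore] -/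
theorem forall_apply_eq_zero_map_red (red : X ⟶ X') (hS' : ∀ s ∈ S, ∀ x : X', X'.ρ s x = x)
    {y : continuousCohomology 1 (subgroupRep X H)}
    (h : ∀ φ : contOneCocycles (subgroupRep X H), oneCocycleClass _ φ = y →
      ∀ s (hs : s ∈ S), φ.1 ⟨s, hSH hs⟩ = 0)
    (ψ : contOneCocycles (subgroupRep X' H))
    (hψ : oneCocycleClass _ ψ = ContinuousCohomology.map (ContinuousMonoidHom.id H)
      (X := subgroupRep X H) (Y := subgroupRep X' H) ((TopRep.resFunctor H.subtype).map red) 1 y)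
    (s : G) (hs : s ∈ S) : ψ.1 ⟨s, hSH hs⟩ = 0 := by
  obtain ⟨φ, rfl⟩ := oneCocycleClass_surjective _ y
  refine forall_apply_eq_zero_of_exists X' H hSH hS' ⟨_, (red_oneCocycleClass red H φ).symm, ?_⟩
    ψ hψ s hs
  intro s hs
  rw [contOneCocycles.pullback_apply]
  change ((TopRep.resFunctor H.subtype).map red).hom (φ.1 ⟨s, hSH hs⟩) = 0
  rw [h φ rfl s hs, map_zero]

/-- **Descent of `Van_S`**: if `κ ∈ H¹(G, X)` restricts on `H ⊇ S` to a class all of whose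
representatives vanish on `S`, then every representative of `κ` vanishes on `S` (its restriction
to `H` is such a representative). No triviality hypothesis needed. [folklore] -/
theorem forall_apply_eq_zero_of_resSubgroup_eq {y : continuousCohomology 1 (subgroupRep X H)}
    (h : ∀ φ : contOneCocycles (subgroupRep X H), oneCocycleClass _ φ = y →
      ∀ s (hs : s ∈ S), φ.1 ⟨s, hSH hs⟩ = 0)
    (κ : continuousCohomology 1 X) (hκ : resSubgroup X H 1 κ = y)
    (Φ : contOneCocycles X) (hΦ : oneCocycleClass X Φ = κ) (s : G) (hs : s ∈ S) : Φ.1 s = 0 := by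
  have hres := resSubgroup_oneCocycleClass X H Φ
  rw [hΦ, hκ] at hres
  have h0 := h _ hres.symm s hs
  rw [contOneCocycles.pullback_apply] at h0
  exact h0

end Van

/-! ### §2 THEOREM B-ur: the derivative class `κ_r` is unramified where `c_{⊥,r}` is -/

section Unramified

variable {K : Type u} [Field K] [NumberField K]
variable {R : Type v} [CommRing R] [TopologicalSpace R]
variable (X X' : TopRep.{u} R (absoluteGaloisGroup K)) (U : Subgroup (absoluteGaloisGroup K)) [U.Normal]

omit [NumberField K] in
/-- A conjugate of a prime of `\bar ℤ_K` above `v` lies above `v`. [folklore] -/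
theorem smul_mem_primesAbove {v : HeightOneSpectrum (𝓞 K)} {𝔓 : Ideal (absIntegers (𝓞 K) K)}
    (h𝔓 : 𝔓 ∈ v.primesAbove) (τ : absoluteGaloisGroup K) : τ • 𝔓 ∈ v.primesAbove := by
  rw [HeightOneSpectrum.mem_primesAbove_iff] at h𝔓 ⊢
  obtain ⟨h1, h2⟩ := h𝔓
  exact ⟨Ideal.IsPrime.smul τ, Ideal.LiesOver.smul τ⟩

omit [NumberField K] in
/-- The union of the inertia groups above `v` is stable under conjugation:
`g⁻¹ I_𝔓 g = I_{g⁻¹ • 𝔓}`. [folklore] -/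
theorem conj_mem_iUnion_inertia {v : HeightOneSpectrum (𝓞 K)} (g s : absoluteGaloisGroup K)
    (hs : s ∈ {t | ∃ 𝔓 ∈ v.primesAbove, t ∈ 𝔓.inertia (absoluteGaloisGroup K)}) :
    g⁻¹ * s * g ∈ {t | ∃ 𝔓 ∈ v.primesAbove, t ∈ 𝔓.inertia (absoluteGaloisGroup K)} := by
  obtain ⟨𝔓, h𝔓, hs⟩ := hs
  refine ⟨g⁻¹ • 𝔓, smul_mem_primesAbove h𝔓 g⁻¹, ?_⟩
  have h := conj_mem_inertia_smul hs g⁻¹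
  rwa [inv_inv] at h

/-- **THEOREM B-ur (Kolyvagin's derivative classes are unramified where the Euler-system class
is).**  Let `U ⊴ Γ_K` be open (normal) and UNRAMIFIED at the finite place `v` (`I_𝔓 ≤ U` for every
`𝔓 ∣ v`), `red : X ⟶ X′` an equivariant coefficient map with every `I_𝔓`, `𝔓 ∣ v`, acting
trivially on `X′`, and `x ∈ H¹(U, X)` a class ALL of whose representatives vanish on every `I_𝔓`,
`𝔓 ∣ v` (for an Euler system, `x = c_{⊥,r}` and this is F6
`Inertia.apply_eq_zero_of_mem_inertia`).  Then every `κ ∈ H¹(Γ_K, X′)` with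
`res_U κ = D_r (red_* x)`, `D_r = ∏_{ℓ∈r} Σ_{j<N_ℓ} j σ_ℓ^j` (THEOREM A3
`existsUnique_res_eq_deriv`: `κ = κ_r`), has ALL its representatives vanishing on every `I_𝔓`,
`𝔓 ∣ v`: `κ_r` is unramified at `v`.  ([Rubin00] Thm. 4.5.1 at `v ∤ rp` with `T` unramified;
[MR04] Prop. A.2 / Remark A.5.) [cite: Rubin2000, Thm. 4.5.1] [cite: MazurRubin2004, App. A Prop. A.2 and Remark A.5 (pp. 79–81)] -/
theorem apply_eq_zero_of_resSubgroup_eq_deriv (red : X ⟶ X') {v : HeightOneSpectrum (𝓞 K)}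
    (hvU : SubgroupIsUnramifiedAt K U v)
    (hX' : ∀ 𝔓 ∈ v.primesAbove, ∀ g ∈ 𝔓.inertia (absoluteGaloisGroup K), ∀ x : X', X'.ρ g x = x)
    (x : continuousCohomology 1 (subgroupRep X U))
    (hx : ∀ φ : contOneCocycles (subgroupRep X U), oneCocycleClass _ φ = x →
      ∀ 𝔓 (h𝔓 : 𝔓 ∈ v.primesAbove), ∀ g (hg : g ∈ 𝔓.inertia (absoluteGaloisGroup K)),
        φ.1 ⟨g, hvU 𝔓 h𝔓 hg⟩ = 0)
    {ι : Type*} (r : Finset ι) (σ : ι → absoluteGaloisGroup K) (N : ι → ℕ) (comm)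
    (κ : continuousCohomology 1 X')
    (hκ : resSubgroup X' U 1 κ = (r.noncommProd (fun ℓ => ∑ j ∈ range (N ℓ),
        (j : Module.End R (continuousCohomology 1 (subgroupRep X' U))) *
          (conjMap X' U (σ ℓ) 1).hom.toLinearMap ^ j) comm)
      (ContinuousCohomology.map (ContinuousMonoidHom.id U) (X := subgroupRep X U)
        (Y := subgroupRep X' U) ((TopRep.resFunctor U.subtype).map red) 1 x))
    (Φ : contOneCocycles X') (hΦ : oneCocycleClass X' Φ = κ)
    {𝔓 : Ideal (absIntegers (𝓞 K) K)} (h𝔓 : 𝔓 ∈ v.primesAbove) {g : absoluteGaloisGroup K}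
    (hg : g ∈ 𝔓.inertia (absoluteGaloisGroup K)) : Φ.1 g = 0 := by
  -- `S = ⋃_{𝔓 ∣ v} I_𝔓 ⊆ U`
  set S : Set (absoluteGaloisGroup K) :=
    {t | ∃ 𝔓 ∈ v.primesAbove, t ∈ 𝔓.inertia (absoluteGaloisGroup K)} with hS_def
  have hSU : S ⊆ U := fun t ⟨𝔓, h𝔓, ht⟩ => hvU 𝔓 h𝔓 ht
  have hS' : ∀ s ∈ S, ∀ x : X', X'.ρ s x = x := fun s ⟨𝔓, h𝔓, hs⟩ => hX' 𝔓 h𝔓 s hs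
  have hSconj : ∀ g s : absoluteGaloisGroup K, s ∈ S → g⁻¹ * s * g ∈ S :=
    fun g s hs => conj_mem_iUnion_inertia g s hs
  -- `x`, then `red_* x`, then `D_r (red_* x)` have all representatives vanishing on `S`
  have hx' : ∀ φ : contOneCocycles (subgroupRep X U), oneCocycleClass _ φ = x →
      ∀ s (hs : s ∈ S), φ.1 ⟨s, hSU hs⟩ = 0 :=
    fun φ hφ s ⟨𝔓, h𝔓, hs⟩ => hx φ hφ 𝔓 h𝔓 s hs
  have hred := forall_apply_eq_zero_map_red X U hSU red hS' hx'
  have hD := forall_apply_eq_zero_noncommProd_deriv X' U hSU hS' hSconj r σ N comm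
    (fun φ hφ s hs => hred φ hφ s hs)
  exact forall_apply_eq_zero_of_resSubgroup_eq X' U hSU (fun φ hφ s hs => hD φ (hφ.trans hκ) s hs)
    κ rfl Φ hΦ g ⟨𝔓, h𝔓, hg⟩

end Unramified

end Derivative

end Summit.BirchSwinnertonDyer.Rank1Residual.GaloisImage

end
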